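import Literature.Probability.Percolation.TriSepEscape
import HarnessLib

/-!
# Forgetting one mark of a five-marked discrete domain

For a `5`-marked discrete domain `D` (Bollobás–Riordan 2006, Ch. 7 §7.2.2 p. 169: marked sites
`v₀,…,v₄` in anticlockwise order, arcs `A₀,…,A₄`) and an index `r : Fin 5`, the domain `D.forget r`
is the SAME site set with the mark `v_r` forgotten and the remaining four marks relabelled from
`v_{r+1}`: its arcs are `A_{r+1}, A_{r+2}, A_{r+3}` and the merged arc `A_{r+4} ∪ A_r` ("by relabelling",
loc. cit. p. 172). It is built with the general re-marking `TriMarkedDomain.remark` exactly as the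
rotation `TriMarkedDomain.rot` of the `3`-marked case, from the explicit table of lifted positions.
Consumer: the five-marked crossing duality (door (v) of the «pcv-sawmu» lane, stub S1(a)), which is
the tree's four-marked duality `tri_markedDomain_duality_holds` applied to `D.forget r`.
(Text of seat a-idea-2 g9 of the lane, HOME sha16 `44f306613d5c758d`; ported with visibility/citation edits only.)
-/

noncomputable section

open Finset

namespace Literature.Probability.Percolation.TriMarkedDomain

variable (D : TriMarkedDomain 5)

/-- The positions of the four kept marks `v_{r+1}, v_{r+2}, v_{r+3}, v_{r+4}`, lifted into the one period
of the boundary cycle starting at the position of `v_{r+1}` (row `r`, column `j`). [folklore] -/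
def fgMarks : Fin 5 → Fin 4 → ℕ :=
  ![![D.pos 1, D.pos 2, D.pos 3, D.pos 4],
    ![D.pos 2, D.pos 3, D.pos 4, D.pos 0 + #(triBdryDarts D.verts)],
    ![D.pos 3, D.pos 4, D.pos 0 + #(triBdryDarts D.verts), D.pos 1 + #(triBdryDarts D.verts)],
    ![D.pos 4, D.pos 0 + #(triBdryDarts D.verts), D.pos 1 + #(triBdryDarts D.verts), D.pos 2 + #(triBdryDarts D.verts)],
    ![D.pos 0, D.pos 1, D.pos 2, D.pos 3]]

/-- The indices of the four kept marks (row `r`, column `j`): `r + 1 + j (mod 5)`. [folklore] -/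
def fgIdx : Fin 5 → Fin 4 → Fin 5 :=
  ![![1, 2, 3, 4], ![2, 3, 4, 0], ![3, 4, 0, 1], ![4, 0, 1, 2], ![0, 1, 2, 3]]

/-- The index table is injective in the column. [folklore] -/
private theorem fgIdx_injective : ∀ r : Fin 5, Function.Injective (fgIdx r) := by decide

/-- The order facts of the five mark positions: `0 = pos 0 < pos 1 < pos 2 < pos 3 < pos 4 < #∂`. [folklore] -/
private theorem pos_facts₅ : D.pos 0 = 0 ∧ D.pos 0 < D.pos 1 ∧ D.pos 1 < D.pos 2 ∧ D.pos 2 < D.pos 3 ∧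
    D.pos 3 < D.pos 4 ∧ D.pos 4 < #(triBdryDarts D.verts) :=
  ⟨D.pos_zero (by norm_num), D.pos_strictMono (by decide), D.pos_strictMono (by decide),
    D.pos_strictMono (by decide), D.pos_strictMono (by decide), D.pos_lt 4⟩

/-- The lifted positions increase along each row. [folklore] -/
private theorem fgMarks_strictMono (r : Fin 5) : StrictMono (D.fgMarks r) := by
  obtain ⟨h0, h01, h12, h23, h34, h4⟩ := D.pos_facts₅
  refine Fin.strictMono_iff_lt_succ.2 fun i => ?_
  fin_cases r <;> fin_cases i
  · show D.pos 1 < D.pos 2; omega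
  · show D.pos 2 < D.pos 3; omega
  · show D.pos 3 < D.pos 4; omega
  · show D.pos 2 < D.pos 3; omega
  · show D.pos 3 < D.pos 4; omega
  · show D.pos 4 < D.pos 0 + #(triBdryDarts D.verts); omega
  · show D.pos 3 < D.pos 4; omega
  · show D.pos 4 < D.pos 0 + #(triBdryDarts D.verts); omega
  · show D.pos 0 + #(triBdryDarts D.verts) < D.pos 1 + #(triBdryDarts D.verts); omega
  · show D.pos 4 < D.pos 0 + #(triBdryDarts D.verts); omega
  · show D.pos 0 + #(triBdryDarts D.verts) < D.pos 1 + #(triBdryDarts D.verts); omega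
  · show D.pos 1 + #(triBdryDarts D.verts) < D.pos 2 + #(triBdryDarts D.verts); omega
  · show D.pos 0 < D.pos 1; omega
  · show D.pos 1 < D.pos 2; omega
  · show D.pos 2 < D.pos 3; omega

/-- The lifted positions lie within one period after the first. [folklore] -/
private theorem fgMarks_lt (r : Fin 5) (j : Fin 4) : D.fgMarks r j < D.fgMarks r 0 + #(triBdryDarts D.verts) := by
  obtain ⟨h0, h01, h12, h23, h34, h4⟩ := D.pos_facts₅
  fin_cases r <;> fin_cases j
  · show D.pos 1 < D.pos 1 + #(triBdryDarts D.verts); omega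
  · show D.pos 2 < D.pos 1 + #(triBdryDarts D.verts); omega
  · show D.pos 3 < D.pos 1 + #(triBdryDarts D.verts); omega
  · show D.pos 4 < D.pos 1 + #(triBdryDarts D.verts); omega
  · show D.pos 2 < D.pos 2 + #(triBdryDarts D.verts); omega
  · show D.pos 3 < D.pos 2 + #(triBdryDarts D.verts); omega
  · show D.pos 4 < D.pos 2 + #(triBdryDarts D.verts); omega
  · show D.pos 0 + #(triBdryDarts D.verts) < D.pos 2 + #(triBdryDarts D.verts); omega
  · show D.pos 3 < D.pos 3 + #(triBdryDarts D.verts); omega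
  · show D.pos 4 < D.pos 3 + #(triBdryDarts D.verts); omega
  · show D.pos 0 + #(triBdryDarts D.verts) < D.pos 3 + #(triBdryDarts D.verts); omega
  · show D.pos 1 + #(triBdryDarts D.verts) < D.pos 3 + #(triBdryDarts D.verts); omega
  · show D.pos 4 < D.pos 4 + #(triBdryDarts D.verts); omega
  · show D.pos 0 + #(triBdryDarts D.verts) < D.pos 4 + #(triBdryDarts D.verts); omega
  · show D.pos 1 + #(triBdryDarts D.verts) < D.pos 4 + #(triBdryDarts D.verts); omega
  · show D.pos 2 + #(triBdryDarts D.verts) < D.pos 4 + #(triBdryDarts D.verts); omega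
  · show D.pos 0 < D.pos 0 + #(triBdryDarts D.verts); omega
  · show D.pos 1 < D.pos 0 + #(triBdryDarts D.verts); omega
  · show D.pos 2 < D.pos 0 + #(triBdryDarts D.verts); omega
  · show D.pos 3 < D.pos 0 + #(triBdryDarts D.verts); omega

/-- The lifted positions are markable. [folklore] -/
private theorem markable_fgMarks (r : Fin 5) (j : Fin 4) : D.Markable (D.fgMarks r j) := by
  fin_cases r <;> fin_cases j
  · exact D.markable_pos 1
  · exact D.markable_pos 2
  · exact D.markable_pos 3
  · exact D.markable_pos 4
  · exact D.markable_pos 2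
  · exact D.markable_pos 3
  · exact D.markable_pos 4
  · show D.Markable (D.pos 0 + #(triBdryDarts D.verts)); rw [add_comm]; exact D.markable_card_add.2 (D.markable_pos 0)
  · exact D.markable_pos 3
  · exact D.markable_pos 4
  · show D.Markable (D.pos 0 + #(triBdryDarts D.verts)); rw [add_comm]; exact D.markable_card_add.2 (D.markable_pos 0)
  · show D.Markable (D.pos 1 + #(triBdryDarts D.verts)); rw [add_comm]; exact D.markable_card_add.2 (D.markable_pos 1)
  · exact D.markable_pos 4
  · show D.Markable (D.pos 0 + #(triBdryDarts D.verts)); rw [add_comm]; exact D.markable_card_add.2 (D.markable_pos 0)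
  · show D.Markable (D.pos 1 + #(triBdryDarts D.verts)); rw [add_comm]; exact D.markable_card_add.2 (D.markable_pos 1)
  · show D.Markable (D.pos 2 + #(triBdryDarts D.verts)); rw [add_comm]; exact D.markable_card_add.2 (D.markable_pos 2)
  · exact D.markable_pos 0
  · exact D.markable_pos 1
  · exact D.markable_pos 2
  · exact D.markable_pos 3

/-- The tails at the lifted positions are the kept marked sites. [folklore] -/
private theorem fst_iter_fgMarks (r : Fin 5) (j : Fin 4) :
    (triBdryIter D.verts D.base (D.fgMarks r j)).1 = D.markSite (fgIdx r j) := by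
  fin_cases r <;> fin_cases j
  · rfl
  · rfl
  · rfl
  · rfl
  · rfl
  · rfl
  · rfl
  · show (triBdryIter D.verts D.base (D.pos 0 + #(triBdryDarts D.verts))).1 = D.markSite 0; rw [D.iter_add_card]; rfl
  · rfl
  · rfl
  · show (triBdryIter D.verts D.base (D.pos 0 + #(triBdryDarts D.verts))).1 = D.markSite 0; rw [D.iter_add_card]; rfl
  · show (triBdryIter D.verts D.base (D.pos 1 + #(triBdryDarts D.verts))).1 = D.markSite 1; rw [D.iter_add_card]; rfl
  · rfl
  · show (triBdryIter D.verts D.base (D.pos 0 + #(triBdryDarts D.verts))).1 = D.markSite 0; rw [D.iter_add_card]; rfl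
  · show (triBdryIter D.verts D.base (D.pos 1 + #(triBdryDarts D.verts))).1 = D.markSite 1; rw [D.iter_add_card]; rfl
  · show (triBdryIter D.verts D.base (D.pos 2 + #(triBdryDarts D.verts))).1 = D.markSite 2; rw [D.iter_add_card]; rfl
  · rfl
  · rfl
  · rfl
  · rfl

/-- The tails at the lifted positions are distinct. [folklore] -/
private theorem fgMarks_injective (r : Fin 5) :
    Function.Injective fun j => (triBdryIter D.verts D.base (D.fgMarks r j)).1 := by
  intro i j h
  simp only [fst_iter_fgMarks] at h
  exact fgIdx_injective r (D.mark_injective h)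

/-- **The domain with the mark `v_r` forgotten**: the same sites, marks `v_{r+1}, v_{r+2}, v_{r+3}, v_{r+4}`
(Bollobás–Riordan 2006, p. 172: "by relabelling"). [cite: BollobasRiordan2006, Ch. 7 §7.2.2 p. 169] -/
def forget (r : Fin 5) : TriMarkedDomain 4 :=
  D.remark (D.fgMarks r) (D.fgMarks_strictMono r) (D.fgMarks_lt r) (D.markable_fgMarks r) (D.fgMarks_injective r)

/-- Forgetting a mark keeps the sites. [cite: BollobasRiordan2006, Ch. 7 §7.2.2 p. 172 (relabelling)] -/
@[simp] theorem forget_verts (r : Fin 5) : (D.forget r).verts = D.verts := rfl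

/-- Stretch `0` of `D.forget 0` is the old stretch `1`. [cite: BollobasRiordan2006, Ch. 7 §7.2.2 p. 172 (relabelling)] -/
theorem forget_zero_stretch_zero : (D.forget 0).stretch 0 = D.stretch 1 := by
  obtain ⟨h0, h01, h12, h23, h34, h4⟩ := D.pos_facts₅
  unfold forget
  rw [D.remark_stretch]
  show (Ico (D.pos 1) (D.pos 2)).image (triBdryIter D.verts D.base) = (Ico (D.pos 1) (D.pos 2)).image (fun n => triBdryIter D.verts D.base n)
  rfl

/-- Stretch `1` of `D.forget 0` is the old stretch `2`. [cite: BollobasRiordan2006, Ch. 7 §7.2.2 p. 172 (relabelling)] -/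
theorem forget_zero_stretch_one : (D.forget 0).stretch 1 = D.stretch 2 := by
  obtain ⟨h0, h01, h12, h23, h34, h4⟩ := D.pos_facts₅
  unfold forget
  rw [D.remark_stretch]
  show (Ico (D.pos 2) (D.pos 3)).image (triBdryIter D.verts D.base) = (Ico (D.pos 2) (D.pos 3)).image (fun n => triBdryIter D.verts D.base n)
  rfl

/-- Stretch `2` of `D.forget 0` is the old stretch `3`. [cite: BollobasRiordan2006, Ch. 7 §7.2.2 p. 172 (relabelling)] -/
theorem forget_zero_stretch_two : (D.forget 0).stretch 2 = D.stretch 3 := by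
  obtain ⟨h0, h01, h12, h23, h34, h4⟩ := D.pos_facts₅
  unfold forget
  rw [D.remark_stretch]
  show (Ico (D.pos 3) (D.pos 4)).image (triBdryIter D.verts D.base) = (Ico (D.pos 3) (D.pos 4)).image (fun n => triBdryIter D.verts D.base n)
  rfl

/-- Stretch `3` of `D.forget 0` is the union of the old stretches `4` and `0`. [cite: BollobasRiordan2006, Ch. 7 §7.2.2 p. 172 (relabelling)] -/
theorem forget_zero_stretch_three : (D.forget 0).stretch 3 = D.stretch 4 ∪ D.stretch 0 := by
  obtain ⟨h0, h01, h12, h23, h34, h4⟩ := D.pos_facts₅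
  have hL := D.isTriDisc.card_pos
  unfold forget
  rw [D.remark_stretch]
  show (Ico (D.pos 4) (D.pos 1 + #(triBdryDarts D.verts))).image (triBdryIter D.verts D.base) = (Ico (D.pos 4) (D.bdryLen)).image (fun n => triBdryIter D.verts D.base n) ∪ (Ico (D.pos 0) (D.pos 1)).image (fun n => triBdryIter D.verts D.base n)
  rw [← Finset.Ico_union_Ico_eq_Ico (a := D.pos 4) (b := #(triBdryDarts D.verts)) (c := D.pos 1 + #(triBdryDarts D.verts)) (by omega) (by omega),
    Finset.image_union]
  refine congrArg₂ (· ∪ ·) rfl ?_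
  rw [h0, show Ico #(triBdryDarts D.verts) (D.pos 1 + #(triBdryDarts D.verts)) = Ico (#(triBdryDarts D.verts) + 0) (#(triBdryDarts D.verts) + D.pos 1) by rw [add_zero, add_comm]]
  exact D.image_Ico_card_add 0 (D.pos 1)

/-- Stretch `0` of `D.forget 1` is the old stretch `2`. [cite: BollobasRiordan2006, Ch. 7 §7.2.2 p. 172 (relabelling)] -/
theorem forget_one_stretch_zero : (D.forget 1).stretch 0 = D.stretch 2 := by
  obtain ⟨h0, h01, h12, h23, h34, h4⟩ := D.pos_facts₅
  unfold forget
  rw [D.remark_stretch]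
  show (Ico (D.pos 2) (D.pos 3)).image (triBdryIter D.verts D.base) = (Ico (D.pos 2) (D.pos 3)).image (fun n => triBdryIter D.verts D.base n)
  rfl

/-- Stretch `1` of `D.forget 1` is the old stretch `3`. [cite: BollobasRiordan2006, Ch. 7 §7.2.2 p. 172 (relabelling)] -/
theorem forget_one_stretch_one : (D.forget 1).stretch 1 = D.stretch 3 := by
  obtain ⟨h0, h01, h12, h23, h34, h4⟩ := D.pos_facts₅
  unfold forget
  rw [D.remark_stretch]
  show (Ico (D.pos 3) (D.pos 4)).image (triBdryIter D.verts D.base) = (Ico (D.pos 3) (D.pos 4)).image (fun n => triBdryIter D.verts D.base n)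
  rfl

/-- Stretch `2` of `D.forget 1` is the old stretch `4`. [cite: BollobasRiordan2006, Ch. 7 §7.2.2 p. 172 (relabelling)] -/
theorem forget_one_stretch_two : (D.forget 1).stretch 2 = D.stretch 4 := by
  obtain ⟨h0, h01, h12, h23, h34, h4⟩ := D.pos_facts₅
  unfold forget
  rw [D.remark_stretch]
  show (Ico (D.pos 4) (D.pos 0 + #(triBdryDarts D.verts))).image (triBdryIter D.verts D.base) = (Ico (D.pos 4) (D.bdryLen)).image (fun n => triBdryIter D.verts D.base n)
  rw [h0, zero_add]; rfl

/-- Stretch `3` of `D.forget 1` is the union of the old stretches `0` and `1`. [cite: BollobasRiordan2006, Ch. 7 §7.2.2 p. 172 (relabelling)] -/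
theorem forget_one_stretch_three : (D.forget 1).stretch 3 = D.stretch 0 ∪ D.stretch 1 := by
  obtain ⟨h0, h01, h12, h23, h34, h4⟩ := D.pos_facts₅
  have hL := D.isTriDisc.card_pos
  unfold forget
  rw [D.remark_stretch]
  show (Ico (D.pos 0 + #(triBdryDarts D.verts)) (D.pos 2 + #(triBdryDarts D.verts))).image (triBdryIter D.verts D.base) = (Ico (D.pos 0) (D.pos 1)).image (fun n => triBdryIter D.verts D.base n) ∪ (Ico (D.pos 1) (D.pos 2)).image (fun n => triBdryIter D.verts D.base n)
  rw [← Finset.Ico_union_Ico_eq_Ico (a := D.pos 0 + #(triBdryDarts D.verts)) (b := D.pos 1 + #(triBdryDarts D.verts)) (c := D.pos 2 + #(triBdryDarts D.verts))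
    (by omega) (by omega), Finset.image_union,
    add_comm (D.pos 0), add_comm (D.pos 1), add_comm (D.pos 2), D.image_Ico_card_add, D.image_Ico_card_add]

/-- Stretch `0` of `D.forget 2` is the old stretch `3`. [cite: BollobasRiordan2006, Ch. 7 §7.2.2 p. 172 (relabelling)] -/
theorem forget_two_stretch_zero : (D.forget 2).stretch 0 = D.stretch 3 := by
  obtain ⟨h0, h01, h12, h23, h34, h4⟩ := D.pos_facts₅
  unfold forget
  rw [D.remark_stretch]
  show (Ico (D.pos 3) (D.pos 4)).image (triBdryIter D.verts D.base) = (Ico (D.pos 3) (D.pos 4)).image (fun n => triBdryIter D.verts D.base n)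
  rfl

/-- Stretch `1` of `D.forget 2` is the old stretch `4`. [cite: BollobasRiordan2006, Ch. 7 §7.2.2 p. 172 (relabelling)] -/
theorem forget_two_stretch_one : (D.forget 2).stretch 1 = D.stretch 4 := by
  obtain ⟨h0, h01, h12, h23, h34, h4⟩ := D.pos_facts₅
  unfold forget
  rw [D.remark_stretch]
  show (Ico (D.pos 4) (D.pos 0 + #(triBdryDarts D.verts))).image (triBdryIter D.verts D.base) = (Ico (D.pos 4) (D.bdryLen)).image (fun n => triBdryIter D.verts D.base n)
  rw [h0, zero_add]; rfl

/-- Stretch `2` of `D.forget 2` is the old stretch `0`. [cite: BollobasRiordan2006, Ch. 7 §7.2.2 p. 172 (relabelling)] -/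
theorem forget_two_stretch_two : (D.forget 2).stretch 2 = D.stretch 0 := by
  obtain ⟨h0, h01, h12, h23, h34, h4⟩ := D.pos_facts₅
  unfold forget
  rw [D.remark_stretch]
  show (Ico (D.pos 0 + #(triBdryDarts D.verts)) (D.pos 1 + #(triBdryDarts D.verts))).image (triBdryIter D.verts D.base) = (Ico (D.pos 0) (D.pos 1)).image (fun n => triBdryIter D.verts D.base n)
  rw [add_comm (D.pos 0), add_comm (D.pos 1)]
  exact D.image_Ico_card_add (D.pos 0) (D.pos 1)

/-- Stretch `3` of `D.forget 2` is the union of the old stretches `1` and `2`. [cite: BollobasRiordan2006, Ch. 7 §7.2.2 p. 172 (relabelling)] -/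
theorem forget_two_stretch_three : (D.forget 2).stretch 3 = D.stretch 1 ∪ D.stretch 2 := by
  obtain ⟨h0, h01, h12, h23, h34, h4⟩ := D.pos_facts₅
  have hL := D.isTriDisc.card_pos
  unfold forget
  rw [D.remark_stretch]
  show (Ico (D.pos 1 + #(triBdryDarts D.verts)) (D.pos 3 + #(triBdryDarts D.verts))).image (triBdryIter D.verts D.base) = (Ico (D.pos 1) (D.pos 2)).image (fun n => triBdryIter D.verts D.base n) ∪ (Ico (D.pos 2) (D.pos 3)).image (fun n => triBdryIter D.verts D.base n)
  rw [← Finset.Ico_union_Ico_eq_Ico (a := D.pos 1 + #(triBdryDarts D.verts)) (b := D.pos 2 + #(triBdryDarts D.verts)) (c := D.pos 3 + #(triBdryDarts D.verts))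
    (by omega) (by omega), Finset.image_union,
    add_comm (D.pos 1), add_comm (D.pos 2), add_comm (D.pos 3), D.image_Ico_card_add, D.image_Ico_card_add]

/-- Stretch `0` of `D.forget 3` is the old stretch `4`. [cite: BollobasRiordan2006, Ch. 7 §7.2.2 p. 172 (relabelling)] -/
theorem forget_three_stretch_zero : (D.forget 3).stretch 0 = D.stretch 4 := by
  obtain ⟨h0, h01, h12, h23, h34, h4⟩ := D.pos_facts₅
  unfold forget
  rw [D.remark_stretch]
  show (Ico (D.pos 4) (D.pos 0 + #(triBdryDarts D.verts))).image (triBdryIter D.verts D.base) = (Ico (D.pos 4) (D.bdryLen)).image (fun n => triBdryIter D.verts D.base n)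
  rw [h0, zero_add]; rfl

/-- Stretch `1` of `D.forget 3` is the old stretch `0`. [cite: BollobasRiordan2006, Ch. 7 §7.2.2 p. 172 (relabelling)] -/
theorem forget_three_stretch_one : (D.forget 3).stretch 1 = D.stretch 0 := by
  obtain ⟨h0, h01, h12, h23, h34, h4⟩ := D.pos_facts₅
  unfold forget
  rw [D.remark_stretch]
  show (Ico (D.pos 0 + #(triBdryDarts D.verts)) (D.pos 1 + #(triBdryDarts D.verts))).image (triBdryIter D.verts D.base) = (Ico (D.pos 0) (D.pos 1)).image (fun n => triBdryIter D.verts D.base n)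
  rw [add_comm (D.pos 0), add_comm (D.pos 1)]
  exact D.image_Ico_card_add (D.pos 0) (D.pos 1)

/-- Stretch `2` of `D.forget 3` is the old stretch `1`. [cite: BollobasRiordan2006, Ch. 7 §7.2.2 p. 172 (relabelling)] -/
theorem forget_three_stretch_two : (D.forget 3).stretch 2 = D.stretch 1 := by
  obtain ⟨h0, h01, h12, h23, h34, h4⟩ := D.pos_facts₅
  unfold forget
  rw [D.remark_stretch]
  show (Ico (D.pos 1 + #(triBdryDarts D.verts)) (D.pos 2 + #(triBdryDarts D.verts))).image (triBdryIter D.verts D.base) = (Ico (D.pos 1) (D.pos 2)).image (fun n => triBdryIter D.verts D.base n)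
  rw [add_comm (D.pos 1), add_comm (D.pos 2)]
  exact D.image_Ico_card_add (D.pos 1) (D.pos 2)

/-- Stretch `3` of `D.forget 3` is the union of the old stretches `2` and `3`. [cite: BollobasRiordan2006, Ch. 7 §7.2.2 p. 172 (relabelling)] -/
theorem forget_three_stretch_three : (D.forget 3).stretch 3 = D.stretch 2 ∪ D.stretch 3 := by
  obtain ⟨h0, h01, h12, h23, h34, h4⟩ := D.pos_facts₅
  have hL := D.isTriDisc.card_pos
  unfold forget
  rw [D.remark_stretch]
  show (Ico (D.pos 2 + #(triBdryDarts D.verts)) (D.pos 4 + #(triBdryDarts D.verts))).image (triBdryIter D.verts D.base) = (Ico (D.pos 2) (D.pos 3)).image (fun n => triBdryIter D.verts D.base n) ∪ (Ico (D.pos 3) (D.pos 4)).image (fun n => triBdryIter D.verts D.base n)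
  rw [← Finset.Ico_union_Ico_eq_Ico (a := D.pos 2 + #(triBdryDarts D.verts)) (b := D.pos 3 + #(triBdryDarts D.verts)) (c := D.pos 4 + #(triBdryDarts D.verts))
    (by omega) (by omega), Finset.image_union,
    add_comm (D.pos 2), add_comm (D.pos 3), add_comm (D.pos 4), D.image_Ico_card_add, D.image_Ico_card_add]

/-- Stretch `0` of `D.forget 4` is the old stretch `0`. [cite: BollobasRiordan2006, Ch. 7 §7.2.2 p. 172 (relabelling)] -/
theorem forget_four_stretch_zero : (D.forget 4).stretch 0 = D.stretch 0 := by
  obtain ⟨h0, h01, h12, h23, h34, h4⟩ := D.pos_facts₅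
  unfold forget
  rw [D.remark_stretch]
  show (Ico (D.pos 0) (D.pos 1)).image (triBdryIter D.verts D.base) = (Ico (D.pos 0) (D.pos 1)).image (fun n => triBdryIter D.verts D.base n)
  rfl

/-- Stretch `1` of `D.forget 4` is the old stretch `1`. [cite: BollobasRiordan2006, Ch. 7 §7.2.2 p. 172 (relabelling)] -/
theorem forget_four_stretch_one : (D.forget 4).stretch 1 = D.stretch 1 := by
  obtain ⟨h0, h01, h12, h23, h34, h4⟩ := D.pos_facts₅
  unfold forget
  rw [D.remark_stretch]
  show (Ico (D.pos 1) (D.pos 2)).image (triBdryIter D.verts D.base) = (Ico (D.pos 1) (D.pos 2)).image (fun n => triBdryIter D.verts D.base n)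
  rfl

/-- Stretch `2` of `D.forget 4` is the old stretch `2`. [cite: BollobasRiordan2006, Ch. 7 §7.2.2 p. 172 (relabelling)] -/
theorem forget_four_stretch_two : (D.forget 4).stretch 2 = D.stretch 2 := by
  obtain ⟨h0, h01, h12, h23, h34, h4⟩ := D.pos_facts₅
  unfold forget
  rw [D.remark_stretch]
  show (Ico (D.pos 2) (D.pos 3)).image (triBdryIter D.verts D.base) = (Ico (D.pos 2) (D.pos 3)).image (fun n => triBdryIter D.verts D.base n)
  rfl

/-- Stretch `3` of `D.forget 4` is the union of the old stretches `3` and `4`. [cite: BollobasRiordan2006, Ch. 7 §7.2.2 p. 172 (relabelling)] -/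
theorem forget_four_stretch_three : (D.forget 4).stretch 3 = D.stretch 3 ∪ D.stretch 4 := by
  obtain ⟨h0, h01, h12, h23, h34, h4⟩ := D.pos_facts₅
  have hL := D.isTriDisc.card_pos
  unfold forget
  rw [D.remark_stretch]
  show (Ico (D.pos 3) (D.pos 0 + #(triBdryDarts D.verts))).image (triBdryIter D.verts D.base) = (Ico (D.pos 3) (D.pos 4)).image (fun n => triBdryIter D.verts D.base n) ∪ (Ico (D.pos 4) (D.bdryLen)).image (fun n => triBdryIter D.verts D.base n)
  rw [h0, zero_add, ← Finset.Ico_union_Ico_eq_Ico (a := D.pos 3) (b := D.pos 4) (c := #(triBdryDarts D.verts)) (by omega) (by omega),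
    Finset.image_union]
  rfl

/-- Arc `0` of `D.forget 0` is the old arc `A_1`. [cite: BollobasRiordan2006, Ch. 7 §7.2.2 p. 172 (relabelling)] -/
theorem forget_zero_arc_zero : (D.forget 0).arc 0 = D.arc 1 := by
  unfold arc; rw [forget_zero_stretch_zero]

/-- Arc `1` of `D.forget 0` is the old arc `A_2`. [cite: BollobasRiordan2006, Ch. 7 §7.2.2 p. 172 (relabelling)] -/
theorem forget_zero_arc_one : (D.forget 0).arc 1 = D.arc 2 := by
  unfold arc; rw [forget_zero_stretch_one]

/-- Arc `2` of `D.forget 0` is the old arc `A_3`. [cite: BollobasRiordan2006, Ch. 7 §7.2.2 p. 172 (relabelling)] -/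
theorem forget_zero_arc_two : (D.forget 0).arc 2 = D.arc 3 := by
  unfold arc; rw [forget_zero_stretch_two]

/-- Arc `3` of `D.forget 0` is the merged arc `A_4 ∪ A_0`. [cite: BollobasRiordan2006, Ch. 7 §7.2.2 p. 172 (relabelling)] -/
theorem forget_zero_arc_three : (D.forget 0).arc 3 = D.arc 4 ∪ D.arc 0 := by
  unfold arc; rw [forget_zero_stretch_three, Finset.image_union]

/-- Arc `0` of `D.forget 1` is the old arc `A_2`. [cite: BollobasRiordan2006, Ch. 7 §7.2.2 p. 172 (relabelling)] -/
theorem forget_one_arc_zero : (D.forget 1).arc 0 = D.arc 2 := by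
  unfold arc; rw [forget_one_stretch_zero]

/-- Arc `1` of `D.forget 1` is the old arc `A_3`. [cite: BollobasRiordan2006, Ch. 7 §7.2.2 p. 172 (relabelling)] -/
theorem forget_one_arc_one : (D.forget 1).arc 1 = D.arc 3 := by
  unfold arc; rw [forget_one_stretch_one]

/-- Arc `2` of `D.forget 1` is the old arc `A_4`. [cite: BollobasRiordan2006, Ch. 7 §7.2.2 p. 172 (relabelling)] -/
theorem forget_one_arc_two : (D.forget 1).arc 2 = D.arc 4 := by
  unfold arc; rw [forget_one_stretch_two]

/-- Arc `3` of `D.forget 1` is the merged arc `A_0 ∪ A_1`. [cite: BollobasRiordan2006, Ch. 7 §7.2.2 p. 172 (relabelling)] -/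
theorem forget_one_arc_three : (D.forget 1).arc 3 = D.arc 0 ∪ D.arc 1 := by
  unfold arc; rw [forget_one_stretch_three, Finset.image_union]

/-- Arc `0` of `D.forget 2` is the old arc `A_3`. [cite: BollobasRiordan2006, Ch. 7 §7.2.2 p. 172 (relabelling)] -/
theorem forget_two_arc_zero : (D.forget 2).arc 0 = D.arc 3 := by
  unfold arc; rw [forget_two_stretch_zero]

/-- Arc `1` of `D.forget 2` is the old arc `A_4`. [cite: BollobasRiordan2006, Ch. 7 §7.2.2 p. 172 (relabelling)] -/
theorem forget_two_arc_one : (D.forget 2).arc 1 = D.arc 4 := by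
  unfold arc; rw [forget_two_stretch_one]

/-- Arc `2` of `D.forget 2` is the old arc `A_0`. [cite: BollobasRiordan2006, Ch. 7 §7.2.2 p. 172 (relabelling)] -/
theorem forget_two_arc_two : (D.forget 2).arc 2 = D.arc 0 := by
  unfold arc; rw [forget_two_stretch_two]

/-- Arc `3` of `D.forget 2` is the merged arc `A_1 ∪ A_2`. [cite: BollobasRiordan2006, Ch. 7 §7.2.2 p. 172 (relabelling)] -/
theorem forget_two_arc_three : (D.forget 2).arc 3 = D.arc 1 ∪ D.arc 2 := by
  unfold arc; rw [forget_two_stretch_three, Finset.image_union]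

/-- Arc `0` of `D.forget 3` is the old arc `A_4`. [cite: BollobasRiordan2006, Ch. 7 §7.2.2 p. 172 (relabelling)] -/
theorem forget_three_arc_zero : (D.forget 3).arc 0 = D.arc 4 := by
  unfold arc; rw [forget_three_stretch_zero]

/-- Arc `1` of `D.forget 3` is the old arc `A_0`. [cite: BollobasRiordan2006, Ch. 7 §7.2.2 p. 172 (relabelling)] -/
theorem forget_three_arc_one : (D.forget 3).arc 1 = D.arc 0 := by
  unfold arc; rw [forget_three_stretch_one]

/-- Arc `2` of `D.forget 3` is the old arc `A_1`. [cite: BollobasRiordan2006, Ch. 7 §7.2.2 p. 172 (relabelling)] -/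
theorem forget_three_arc_two : (D.forget 3).arc 2 = D.arc 1 := by
  unfold arc; rw [forget_three_stretch_two]

/-- Arc `3` of `D.forget 3` is the merged arc `A_2 ∪ A_3`. [cite: BollobasRiordan2006, Ch. 7 §7.2.2 p. 172 (relabelling)] -/
theorem forget_three_arc_three : (D.forget 3).arc 3 = D.arc 2 ∪ D.arc 3 := by
  unfold arc; rw [forget_three_stretch_three, Finset.image_union]

/-- Arc `0` of `D.forget 4` is the old arc `A_0`. [cite: BollobasRiordan2006, Ch. 7 §7.2.2 p. 172 (relabelling)] -/
theorem forget_four_arc_zero : (D.forget 4).arc 0 = D.arc 0 := by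
  unfold arc; rw [forget_four_stretch_zero]

/-- Arc `1` of `D.forget 4` is the old arc `A_1`. [cite: BollobasRiordan2006, Ch. 7 §7.2.2 p. 172 (relabelling)] -/
theorem forget_four_arc_one : (D.forget 4).arc 1 = D.arc 1 := by
  unfold arc; rw [forget_four_stretch_one]

/-- Arc `2` of `D.forget 4` is the old arc `A_2`. [cite: BollobasRiordan2006, Ch. 7 §7.2.2 p. 172 (relabelling)] -/
theorem forget_four_arc_two : (D.forget 4).arc 2 = D.arc 2 := by
  unfold arc; rw [forget_four_stretch_two]

/-- Arc `3` of `D.forget 4` is the merged arc `A_3 ∪ A_4`. [cite: BollobasRiordan2006, Ch. 7 §7.2.2 p. 172 (relabelling)] -/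
theorem forget_four_arc_three : (D.forget 4).arc 3 = D.arc 3 ∪ D.arc 4 := by
  unfold arc; rw [forget_four_stretch_three, Finset.image_union]

/-- **Forgetting a mark of a five-marked domain**: for every `r` there is a four-marked domain on the
same sites whose arcs are `A_{r+1}, A_{r+2}, A_{r+3}` and `A_{r+4} ∪ A_r` — the statement
`V20.ForgetSuperArc` of the lane's door-(v) skeleton, closed by `D.forget r`. [cite: BollobasRiordan2006, Ch. 7 §7.2.2 p. 169] -/
theorem exists_forget_arcs (D : TriMarkedDomain 5) (r : Fin 5) :
    ∃ D' : TriMarkedDomain 4, D'.verts = D.verts ∧ D'.arc 0 = D.arc (r + 1) ∧ D'.arc 1 = D.arc (r + 2) ∧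
      D'.arc 2 = D.arc (r + 3) ∧ D'.arc 3 = D.arc (r + 4) ∪ D.arc r := by
  fin_cases r
  · exact ⟨D.forget 0, rfl, D.forget_zero_arc_zero, D.forget_zero_arc_one, D.forget_zero_arc_two, D.forget_zero_arc_three⟩
  · exact ⟨D.forget 1, rfl, D.forget_one_arc_zero, D.forget_one_arc_one, D.forget_one_arc_two, D.forget_one_arc_three⟩
  · exact ⟨D.forget 2, rfl, D.forget_two_arc_zero, D.forget_two_arc_one, D.forget_two_arc_two, D.forget_two_arc_three⟩
  · exact ⟨D.forget 3, rfl, D.forget_three_arc_zero, D.forget_three_arc_one, D.forget_three_arc_two, D.forget_three_arc_three⟩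
  · exact ⟨D.forget 4, rfl, D.forget_four_arc_zero, D.forget_four_arc_one, D.forget_four_arc_two, D.forget_four_arc_three⟩

end Literature.Probability.Percolation.TriMarkedDomain

namespace Literature.Probability.Percolation

/-- **Five-marked crossing duality** (Bollobás–Riordan 2006, Ch. 7 Lemma 5 applied to the domain with the
mark `v_r` forgotten): whatever the states of the sites of a `5`-marked discrete domain, EITHER there is an
open crossing `A_{r+1} ↔ A_{r+3}` OR a closed crossing from `A_{r+2}` to the merged arc `A_{r+4} ∪ A_r`, and
not both — the cluster form of «matching A XOR matching B» behind the five-point observable (door (v)).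
An instance of the printed four-arc duality (its loop-model form: Khristoforov–Smirnov 2021, Lemma 2), transported
through `TriMarkedDomain.forget`; no new mathematics is claimed.
[cite: BollobasRiordan2006, Ch. 7 Lemma 5 p. 169][cite: KhristoforovSmirnov2021, Lemma 2] -/
theorem five_markedDomain_duality (D : TriMarkedDomain 5) (ω : SiteConfig (LatticeModels.Site 2)) (r : Fin 5) :
    Xor (D.IsOpenCrossing ω (r + 1) (r + 3))
      (D.IsClosedCrossing ω (r + 2) (r + 4) ∨ D.IsClosedCrossing ω (r + 2) r) := by
  obtain ⟨D', hv, h0, h1, h2, h3⟩ := D.exists_forget_arcs r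
  simpa only [TriMarkedDomain.IsOpenCrossing, TriMarkedDomain.IsClosedCrossing, h0, h1, h2, h3, hv,
    Finset.mem_union, or_and_right, and_or_left, exists_or] using tri_markedDomain_duality_holds D' ω

end Literature.Probability.Percolation

end
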